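import Summits.QuantumFields.YangMills.Theorems.BalabanUVNodesN21ShellSplitOfRecord13CoPHKeyed
import Summits.QuantumFields.YangMills.Theorems.BalabanUVNodesSpineReadingOfRecord13CoPHV
import Summits.QuantumFields.YangMills.Theorems.BalabanUVNodesN21DilationRoadAtRecord13CoPH

/-!
# N21 (NE7c) · JUNCTION: dag-n21-d's SHELL SPLIT OF RECORD knit (`shellWeightBound_classSet₁₃_of_cubeAC` ∕ `…_crOfRecord₁₃At_shellSplit`, p≥591252) WITH THE
# DILATION ROAD's LEVEL CONSTANTS — the `Summable (D_K ρ_K)` and `0 ≤ D_K` binders DISCHARGED in the shape `D_K = M_K·3(d_K+1)∕(1−ρ_K)` (polynomial `M, d`,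
# widths `≤ ½` at a geometric rate; p583987 `summable_dilationCoeffConst_mul` ∕ `dilationCoeffConst_nonneg` BY NAME), at the carriers, at `crOfRecord₁₃At`, and at the
# V edition `crOfRecord₁₃VAt` (n20-d `shellWeightBound_crOfRecord₁₃VAt` BY NAME)

Track A of `YM-PLAN.md` (cell `pub-ymgap`, HUMAN RULING D-0062 ∕ D-0149 width seats), node **N21**; WIDTH SEAT `pub-ymgap-dag-n21-w2` (gen 0), W-SEAT-START-LIST §n21
ITEM 2, file 7 — the junction of the two N21 sub-lanes at the record: dag-n21-d g9's s2 knit (the shell split of record `shellSplitOfRecord₁₃At`, (R)-fields ∕ cover ∕ count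
PROVED, (M1) per top cube DISPLAYED with constant `D_K ρ_K`) × this seat's road-II currency (the per-top-cube constant in the DILATION shape).  THEOREMS ONLY: 0 `def`, 0 `sorry`;
COUNT-NEUTRAL; `--kind proof --supports stmt-QuantumFields-20544 --as helper`.  Imports dag-n21-d's `…N21ShellSplitOfRecord13CoPHKeyed`, n20-d's V edition and my p583987.
NO Theses import.  Restates nothing; cites by name.

WHAT IS PROVED ([bookkeeping]; one application each after the two arithmetic facts).
* ★★ `shellWeightBound_classSet₁₃_of_cubeAC_dilation` — dag-n21-d's ★★ at the carriers `(1, classSet₁₃, weightA₁₃, weightB₁₃, shellA₁₃ ρA, shellB₁₃ ρB)` with, per run,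
  `D_K := M_K·3(d_K+1)∕(1−ρ_K)`: the binders `0 ≤ D_K` and `Summable (D_K ρ_K)` are REPLACED by `0 ≤ M_K ≤ M̄(K^q+1)`, `0 ≤ d_K ≤ d₀(K^p+1)`, `0 ≤ ρ_K ≤ ½`,
  `ρ_K ≤ c₁ϑ^K`, `0 ≤ ϑ < 1` (the per-top-cube (M1) stays displayed, now with the dilation constant).
* ★★ `shellWeightBound_crOfRecord₁₃At_shellSplit_dilation` — the same AT `crOfRecord₁₃At K₀ jcut (shellSplitOfRecord₁₃At N K₀ ρA ρB)` (width LETTERS `ρA ρB : WidthLetter₁₃CoPH N`;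
  n20-d `shellWeightBound_crOfRecord₁₃At` BY NAME).
* ★★ `shellWeightBound_crOfRecord₁₃VAt_shellSplit_dilation` — the same AT THE V EDITION `crOfRecord₁₃VAt …` (`vol := F.side ^ 4`, the K3⁷ v3 pointer; n20-d
  `shellWeightBound_crOfRecord₁₃VAt` BY NAME; the shell face is volume-blind).

HONEST FRAMING.  The per-top-cube (M1) on the record's `a`-truncated dressed law (dag-n21-d's displayed estimate, NOT PRINTED ∕ NOT PROVED; its measure form is their
`cubeLawOfDatum₉` ∕ `…Law` file), (H-U), `0 ≤ ζ`, F3's (e1) integrability rows and the polynomial ∕ width letters (lens N210 ∕ Card 90) are HYPOTHESES; `jcut` displayed;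
no inhabitant of any admissible Stage-13 tuple with provisos claimed (K0⁷ OPEN); nothing of Bałaban's asserted; NE7c NOT PRINTED ∕ NOT proved; **N21 NOT discharged**; K3⁷
NOT claimed; counts UNMOVED (typed 28∕28 · discharged 5∕27); one finite four-torus programme at fixed `ε` — NOT ℝ⁴, NOT infinite volume, NOT OS, NOT a mass gap, NOT Clay.
No decl below carries a cite tag.
-/

set_option autoImplicit false

open scoped BigOperators
open Finset MeasureTheory

namespace Summit.QuantumFields.YangMills.Theorems.N21DilationRoadAtRecord13CoPH

open Literature.MathematicalPhysics.QuantumFieldTheory.Balaban1983to89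
open Literature.MathematicalPhysics.QuantumFieldTheory.Balaban1983to89.T4Continuum
open Literature.MathematicalPhysics.QuantumFieldTheory.Balaban1983to89.Node00
open T4IndicatorShell (ShellWeightBound)
open YMDAG.UVSplit (crOfRecord₁₃At crOfRecord₁₃VAt ShellSplit₁₃CoPH runA₁₃ runB₁₃ histA₁₃ histB₁₃ classSet₁₃ weightA₁₃ weightB₁₃
  shellWeightBound_crOfRecord₁₃At shellWeightBound_crOfRecord₁₃VAt)
open N21ShellSplitOfRecord13CoPH (shellA₁₃ shellB₁₃ shellPieceOfDatum₉ cubeWeightOfDatum₉ WidthLetter₁₃CoPH shellSplitOfRecord₁₃At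
  shellWeightBound_classSet₁₃_of_cubeAC)

variable {F : T4Family} {N : ℕ} [NeZero N]

/-- ★★ **dag-n21-d's KNIT AT THE CARRIERS OF RECORD WITH DILATION CONSTANTS.**  `shellWeightBound_classSet₁₃_of_cubeAC` with, per run, the per-top-cube (M1) constant
`D_K := M_K·3(d_K+1)∕(1−ρ_K)` — its `0 ≤ D_K` and `Summable (D_K ρ_K)` binders DISCHARGED by p583987's `dilationCoeffConst_nonneg` ∕ `summable_dilationCoeffConst_mul` under
`0 ≤ M_K ≤ M̄(K^q+1)`, `0 ≤ d_K ≤ d₀(K^p+1)`, `0 ≤ ρ_K ≤ ½`, `ρ_K ≤ c₁ϑ^K`, `0 ≤ ϑ < 1`; (H-U), `0 ≤ ζ`, the (e1) rows and the per-top-cube (M1) displayed.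
HYPOTHESES only; NE7c NOT proved. [bookkeeping] -/
theorem shellWeightBound_classSet₁₃_of_cubeAC_dilation (K₀ : ℕ) (θ : Stage13HParams F N) (hP : θ.Provisos₁₃CoPH F N) (g₀ : ℕ → ℝ) (os : List (ULoop F))
    (hU : LocalBgMeasurable F N θ.ν) (hζ0 : ∀ p g k s Pl Ql RS U V', 0 ≤ θ.ζ p g k s Pl Ql RS U V')
    (hintA : ∀ (K : ℕ) (t : ℝ) (s : SeqOfRecord F θ.ν θ.τ9.M (histA₁₃ θ K₀ g₀ K) (K₀ + K) (K₀ + K)),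
      Integrable (fun V => chiSeqOfRecord F N θ.ν θ.τ9.M (histA₁₃ θ K₀ g₀ K) (K₀ + K) (K₀ + K) s V *
        dressedSlotsOfDatum₉ F N θ.toStage9Params (datumOfRecord₁₃CoPH F N θ hP) g₀ os t (runA₁₃ F K₀ g₀ K) (histA₁₃ θ K₀ g₀ K) (K₀ + K) s V)
        (fieldMeasure (F.P (K₀ + K)) (K₀ + K) (SU N)))
    (hintB : ∀ (K : ℕ) (t : ℝ) (s' : SeqOfRecord F θ.ν θ.τ9.M (histB₁₃ θ K₀ g₀ K) (K₀ + K + 1) (K₀ + K + 1)),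
      Integrable (fun V => chiSeqOfRecord F N θ.ν θ.τ9.M (histB₁₃ θ K₀ g₀ K) (K₀ + K + 1) (K₀ + K + 1) s' V *
        dressedSlotsOfDatum₉ F N θ.toStage9Params (datumOfRecord₁₃CoPH F N θ hP) g₀ os t (runB₁₃ F K₀ g₀ K) (histB₁₃ θ K₀ g₀ K) (K₀ + K + 1) s' V)
        (fieldMeasure (F.P (K₀ + K + 1)) (K₀ + K + 1) (SU N)))
    {ρA ρB MA dA MB dB : ℕ → ℝ} {Mbar d₀ c₁ ϑ : ℝ} {p q : ℕ} (hϑ0 : 0 ≤ ϑ) (hϑ1 : ϑ < 1)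
    (hMA0 : ∀ K, 0 ≤ MA K) (hMA : ∀ K, MA K ≤ Mbar * ((K : ℝ) ^ q + 1)) (hMB0 : ∀ K, 0 ≤ MB K) (hMB : ∀ K, MB K ≤ Mbar * ((K : ℝ) ^ q + 1))
    (hdA0 : ∀ K, 0 ≤ dA K) (hdA : ∀ K, dA K ≤ d₀ * ((K : ℝ) ^ p + 1)) (hdB0 : ∀ K, 0 ≤ dB K) (hdB : ∀ K, dB K ≤ d₀ * ((K : ℝ) ^ p + 1))
    (hρA0 : ∀ K, 0 ≤ ρA K) (hρAhalf : ∀ K, ρA K ≤ 1 / 2) (hρA : ∀ K, ρA K ≤ c₁ * ϑ ^ K)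
    (hρB0 : ∀ K, 0 ≤ ρB K) (hρBhalf : ∀ K, ρB K ≤ 1 / 2) (hρB : ∀ K, ρB K ≤ c₁ * ϑ ^ K)
    (hM1A : ∀ (K : ℕ) (t : ℝ), |t| ≤ 1 →
      ∀ a : ↥(cubeIndices (F.P (K₀ + K)) (cubeSide (F.P (K₀ + K)).L θ.ν.M₂ (RkOfRecord (F.P (K₀ + K)).L θ.ν.r (histA₁₃ θ K₀ g₀ K (K₀ + K))) (K₀ + K))),
        ∑ s, shellPieceOfDatum₉ F N θ.toStage9Params (datumOfRecord₁₃CoPH F N θ hP) g₀ os (runA₁₃ F K₀ g₀ K) (histA₁₃ θ K₀ g₀ K) (K₀ + K) (ρA K) t a s ≤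
          ((MA K * (3 * (dA K + 1) / (1 - ρA K))) * ρA K) *
            ∑ s, cubeWeightOfDatum₉ F N θ.toStage9Params (datumOfRecord₁₃CoPH F N θ hP) g₀ os (runA₁₃ F K₀ g₀ K) (histA₁₃ θ K₀ g₀ K) (K₀ + K) t a s)
    (hM1B : ∀ (K : ℕ) (t : ℝ), |t| ≤ 1 →
      ∀ a : ↥(cubeIndices (F.P (K₀ + K + 1)) (cubeSide (F.P (K₀ + K + 1)).L θ.ν.M₂
          (RkOfRecord (F.P (K₀ + K + 1)).L θ.ν.r (histB₁₃ θ K₀ g₀ K (K₀ + K + 1))) (K₀ + K + 1))),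
        ∑ s', shellPieceOfDatum₉ F N θ.toStage9Params (datumOfRecord₁₃CoPH F N θ hP) g₀ os (runB₁₃ F K₀ g₀ K) (histB₁₃ θ K₀ g₀ K) (K₀ + K + 1) (ρB K) t a s' ≤
          ((MB K * (3 * (dB K + 1) / (1 - ρB K))) * ρB K) *
            ∑ s', cubeWeightOfDatum₉ F N θ.toStage9Params (datumOfRecord₁₃CoPH F N θ hP) g₀ os (runB₁₃ F K₀ g₀ K) (histB₁₃ θ K₀ g₀ K) (K₀ + K + 1) t a s') :
    ShellWeightBound 1 (classSet₁₃ θ K₀ g₀) (weightA₁₃ θ hP K₀ g₀ os) (weightB₁₃ θ hP K₀ g₀ os) (shellA₁₃ θ hP K₀ g₀ os ρA) (shellB₁₃ θ hP K₀ g₀ os ρB)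
      (fun K => (2 * (F.L : ℝ) ^ F.m) ^ 4 *
        ((MA K * (3 * (dA K + 1) / (1 - ρA K))) * ρA K + (MB K * (3 * (dB K + 1) / (1 - ρB K))) * ρB K)) :=
  shellWeightBound_classSet₁₃_of_cubeAC K₀ θ hP g₀ os hU hζ0 hintA hintB hρA0
    (fun K => dilationCoeffConst_nonneg (hMA0 K) (hdA0 K) (by linarith [hρAhalf K])) hρB0
    (fun K => dilationCoeffConst_nonneg (hMB0 K) (hdB0 K) (by linarith [hρBhalf K]))
    (summable_dilationCoeffConst_mul hϑ0 hϑ1 hMA0 hMA hdA0 hdA hρA0 hρAhalf hρA)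
    (summable_dilationCoeffConst_mul hϑ0 hϑ1 hMB0 hMB hdB0 hdB hρB0 hρBhalf hρB) hM1A hM1B

/-- ★★ **… AT THE READING OF RECORD** `crOfRecord₁₃At K₀ jcut (shellSplitOfRecord₁₃At N K₀ ρA ρB)` (width LETTERS `ρA ρB : WidthLetter₁₃CoPH N`, the dilation letters read at
the tuple): `ShellWeightBound` at the reading with its canonical `Wsh` (n20-d `shellWeightBound_crOfRecord₁₃At` BY NAME).  HYPOTHESES only. [bookkeeping] -/
theorem shellWeightBound_crOfRecord₁₃At_shellSplit_dilation (K₀ : ℕ) (jcut : ℕ → ℕ) (ρA ρB : WidthLetter₁₃CoPH N) (θ : Stage13HParams F N)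
    (hP : θ.Provisos₁₃CoPH F N) (g₀ : ℕ → ℝ) (os : List (ULoop F))
    (hU : LocalBgMeasurable F N θ.ν) (hζ0 : ∀ p g k s Pl Ql RS U V', 0 ≤ θ.ζ p g k s Pl Ql RS U V')
    (hintA : ∀ (K : ℕ) (t : ℝ) (s : SeqOfRecord F θ.ν θ.τ9.M (histA₁₃ θ K₀ g₀ K) (K₀ + K) (K₀ + K)),
      Integrable (fun V => chiSeqOfRecord F N θ.ν θ.τ9.M (histA₁₃ θ K₀ g₀ K) (K₀ + K) (K₀ + K) s V *
        dressedSlotsOfDatum₉ F N θ.toStage9Params (datumOfRecord₁₃CoPH F N θ hP) g₀ os t (runA₁₃ F K₀ g₀ K) (histA₁₃ θ K₀ g₀ K) (K₀ + K) s V)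
        (fieldMeasure (F.P (K₀ + K)) (K₀ + K) (SU N)))
    (hintB : ∀ (K : ℕ) (t : ℝ) (s' : SeqOfRecord F θ.ν θ.τ9.M (histB₁₃ θ K₀ g₀ K) (K₀ + K + 1) (K₀ + K + 1)),
      Integrable (fun V => chiSeqOfRecord F N θ.ν θ.τ9.M (histB₁₃ θ K₀ g₀ K) (K₀ + K + 1) (K₀ + K + 1) s' V *
        dressedSlotsOfDatum₉ F N θ.toStage9Params (datumOfRecord₁₃CoPH F N θ hP) g₀ os t (runB₁₃ F K₀ g₀ K) (histB₁₃ θ K₀ g₀ K) (K₀ + K + 1) s' V)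
        (fieldMeasure (F.P (K₀ + K + 1)) (K₀ + K + 1) (SU N)))
    {MA dA MB dB : ℕ → ℝ} {Mbar d₀ c₁ ϑ : ℝ} {p q : ℕ} (hϑ0 : 0 ≤ ϑ) (hϑ1 : ϑ < 1)
    (hMA0 : ∀ K, 0 ≤ MA K) (hMA : ∀ K, MA K ≤ Mbar * ((K : ℝ) ^ q + 1)) (hMB0 : ∀ K, 0 ≤ MB K) (hMB : ∀ K, MB K ≤ Mbar * ((K : ℝ) ^ q + 1))
    (hdA0 : ∀ K, 0 ≤ dA K) (hdA : ∀ K, dA K ≤ d₀ * ((K : ℝ) ^ p + 1)) (hdB0 : ∀ K, 0 ≤ dB K) (hdB : ∀ K, dB K ≤ d₀ * ((K : ℝ) ^ p + 1))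
    (hρA0 : ∀ K, 0 ≤ ρA F θ hP g₀ os K) (hρAhalf : ∀ K, ρA F θ hP g₀ os K ≤ 1 / 2) (hρA : ∀ K, ρA F θ hP g₀ os K ≤ c₁ * ϑ ^ K)
    (hρB0 : ∀ K, 0 ≤ ρB F θ hP g₀ os K) (hρBhalf : ∀ K, ρB F θ hP g₀ os K ≤ 1 / 2) (hρB : ∀ K, ρB F θ hP g₀ os K ≤ c₁ * ϑ ^ K)
    (hM1A : ∀ (K : ℕ) (t : ℝ), |t| ≤ 1 →
      ∀ a : ↥(cubeIndices (F.P (K₀ + K)) (cubeSide (F.P (K₀ + K)).L θ.ν.M₂ (RkOfRecord (F.P (K₀ + K)).L θ.ν.r (histA₁₃ θ K₀ g₀ K (K₀ + K))) (K₀ + K))),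
        ∑ s, shellPieceOfDatum₉ F N θ.toStage9Params (datumOfRecord₁₃CoPH F N θ hP) g₀ os (runA₁₃ F K₀ g₀ K) (histA₁₃ θ K₀ g₀ K) (K₀ + K)
            (ρA F θ hP g₀ os K) t a s ≤
          ((MA K * (3 * (dA K + 1) / (1 - ρA F θ hP g₀ os K))) * ρA F θ hP g₀ os K) *
            ∑ s, cubeWeightOfDatum₉ F N θ.toStage9Params (datumOfRecord₁₃CoPH F N θ hP) g₀ os (runA₁₃ F K₀ g₀ K) (histA₁₃ θ K₀ g₀ K) (K₀ + K) t a s)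
    (hM1B : ∀ (K : ℕ) (t : ℝ), |t| ≤ 1 →
      ∀ a : ↥(cubeIndices (F.P (K₀ + K + 1)) (cubeSide (F.P (K₀ + K + 1)).L θ.ν.M₂
          (RkOfRecord (F.P (K₀ + K + 1)).L θ.ν.r (histB₁₃ θ K₀ g₀ K (K₀ + K + 1))) (K₀ + K + 1))),
        ∑ s', shellPieceOfDatum₉ F N θ.toStage9Params (datumOfRecord₁₃CoPH F N θ hP) g₀ os (runB₁₃ F K₀ g₀ K) (histB₁₃ θ K₀ g₀ K) (K₀ + K + 1)
            (ρB F θ hP g₀ os K) t a s' ≤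
          ((MB K * (3 * (dB K + 1) / (1 - ρB F θ hP g₀ os K))) * ρB F θ hP g₀ os K) *
            ∑ s', cubeWeightOfDatum₉ F N θ.toStage9Params (datumOfRecord₁₃CoPH F N θ hP) g₀ os (runB₁₃ F K₀ g₀ K) (histB₁₃ θ K₀ g₀ K) (K₀ + K + 1) t a s') :
    letI S := crOfRecord₁₃At K₀ jcut (shellSplitOfRecord₁₃At N K₀ ρA ρB) F θ hP g₀ os
    ShellWeightBound S.l₀ S.T S.A S.B S.shA S.shB S.Wsh :=
  shellWeightBound_crOfRecord₁₃At K₀ jcut (shellSplitOfRecord₁₃At N K₀ ρA ρB) θ hP g₀ os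
    (shellWeightBound_classSet₁₃_of_cubeAC_dilation K₀ θ hP g₀ os hU hζ0 hintA hintB hϑ0 hϑ1 hMA0 hMA hMB0 hMB hdA0 hdA hdB0 hdB
      hρA0 hρAhalf hρA hρB0 hρBhalf hρB hM1A hM1B)

/-- ★★ **… AT THE V EDITION** `crOfRecord₁₃VAt K₀ jcut (shellSplitOfRecord₁₃At N K₀ ρA ρB)` (`vol := F.side ^ 4`, the K3⁷ v3 pointer of record; the shell face is
volume-blind: n20-d `shellWeightBound_crOfRecord₁₃VAt` BY NAME).  HYPOTHESES only. [bookkeeping] -/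
theorem shellWeightBound_crOfRecord₁₃VAt_shellSplit_dilation (K₀ : ℕ) (jcut : ℕ → ℕ) (ρA ρB : WidthLetter₁₃CoPH N) (θ : Stage13HParams F N)
    (hP : θ.Provisos₁₃CoPH F N) (g₀ : ℕ → ℝ) (os : List (ULoop F))
    (hU : LocalBgMeasurable F N θ.ν) (hζ0 : ∀ p g k s Pl Ql RS U V', 0 ≤ θ.ζ p g k s Pl Ql RS U V')
    (hintA : ∀ (K : ℕ) (t : ℝ) (s : SeqOfRecord F θ.ν θ.τ9.M (histA₁₃ θ K₀ g₀ K) (K₀ + K) (K₀ + K)),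
      Integrable (fun V => chiSeqOfRecord F N θ.ν θ.τ9.M (histA₁₃ θ K₀ g₀ K) (K₀ + K) (K₀ + K) s V *
        dressedSlotsOfDatum₉ F N θ.toStage9Params (datumOfRecord₁₃CoPH F N θ hP) g₀ os t (runA₁₃ F K₀ g₀ K) (histA₁₃ θ K₀ g₀ K) (K₀ + K) s V)
        (fieldMeasure (F.P (K₀ + K)) (K₀ + K) (SU N)))
    (hintB : ∀ (K : ℕ) (t : ℝ) (s' : SeqOfRecord F θ.ν θ.τ9.M (histB₁₃ θ K₀ g₀ K) (K₀ + K + 1) (K₀ + K + 1)),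
      Integrable (fun V => chiSeqOfRecord F N θ.ν θ.τ9.M (histB₁₃ θ K₀ g₀ K) (K₀ + K + 1) (K₀ + K + 1) s' V *
        dressedSlotsOfDatum₉ F N θ.toStage9Params (datumOfRecord₁₃CoPH F N θ hP) g₀ os t (runB₁₃ F K₀ g₀ K) (histB₁₃ θ K₀ g₀ K) (K₀ + K + 1) s' V)
        (fieldMeasure (F.P (K₀ + K + 1)) (K₀ + K + 1) (SU N)))
    {MA dA MB dB : ℕ → ℝ} {Mbar d₀ c₁ ϑ : ℝ} {p q : ℕ} (hϑ0 : 0 ≤ ϑ) (hϑ1 : ϑ < 1)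
    (hMA0 : ∀ K, 0 ≤ MA K) (hMA : ∀ K, MA K ≤ Mbar * ((K : ℝ) ^ q + 1)) (hMB0 : ∀ K, 0 ≤ MB K) (hMB : ∀ K, MB K ≤ Mbar * ((K : ℝ) ^ q + 1))
    (hdA0 : ∀ K, 0 ≤ dA K) (hdA : ∀ K, dA K ≤ d₀ * ((K : ℝ) ^ p + 1)) (hdB0 : ∀ K, 0 ≤ dB K) (hdB : ∀ K, dB K ≤ d₀ * ((K : ℝ) ^ p + 1))
    (hρA0 : ∀ K, 0 ≤ ρA F θ hP g₀ os K) (hρAhalf : ∀ K, ρA F θ hP g₀ os K ≤ 1 / 2) (hρA : ∀ K, ρA F θ hP g₀ os K ≤ c₁ * ϑ ^ K)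
    (hρB0 : ∀ K, 0 ≤ ρB F θ hP g₀ os K) (hρBhalf : ∀ K, ρB F θ hP g₀ os K ≤ 1 / 2) (hρB : ∀ K, ρB F θ hP g₀ os K ≤ c₁ * ϑ ^ K)
    (hM1A : ∀ (K : ℕ) (t : ℝ), |t| ≤ 1 →
      ∀ a : ↥(cubeIndices (F.P (K₀ + K)) (cubeSide (F.P (K₀ + K)).L θ.ν.M₂ (RkOfRecord (F.P (K₀ + K)).L θ.ν.r (histA₁₃ θ K₀ g₀ K (K₀ + K))) (K₀ + K))),
        ∑ s, shellPieceOfDatum₉ F N θ.toStage9Params (datumOfRecord₁₃CoPH F N θ hP) g₀ os (runA₁₃ F K₀ g₀ K) (histA₁₃ θ K₀ g₀ K) (K₀ + K)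
            (ρA F θ hP g₀ os K) t a s ≤
          ((MA K * (3 * (dA K + 1) / (1 - ρA F θ hP g₀ os K))) * ρA F θ hP g₀ os K) *
            ∑ s, cubeWeightOfDatum₉ F N θ.toStage9Params (datumOfRecord₁₃CoPH F N θ hP) g₀ os (runA₁₃ F K₀ g₀ K) (histA₁₃ θ K₀ g₀ K) (K₀ + K) t a s)
    (hM1B : ∀ (K : ℕ) (t : ℝ), |t| ≤ 1 →
      ∀ a : ↥(cubeIndices (F.P (K₀ + K + 1)) (cubeSide (F.P (K₀ + K + 1)).L θ.ν.M₂
          (RkOfRecord (F.P (K₀ + K + 1)).L θ.ν.r (histB₁₃ θ K₀ g₀ K (K₀ + K + 1))) (K₀ + K + 1))),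
        ∑ s', shellPieceOfDatum₉ F N θ.toStage9Params (datumOfRecord₁₃CoPH F N θ hP) g₀ os (runB₁₃ F K₀ g₀ K) (histB₁₃ θ K₀ g₀ K) (K₀ + K + 1)
            (ρB F θ hP g₀ os K) t a s' ≤
          ((MB K * (3 * (dB K + 1) / (1 - ρB F θ hP g₀ os K))) * ρB F θ hP g₀ os K) *
            ∑ s', cubeWeightOfDatum₉ F N θ.toStage9Params (datumOfRecord₁₃CoPH F N θ hP) g₀ os (runB₁₃ F K₀ g₀ K) (histB₁₃ θ K₀ g₀ K) (K₀ + K + 1) t a s') :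
    letI S := crOfRecord₁₃VAt K₀ jcut (shellSplitOfRecord₁₃At N K₀ ρA ρB) F θ hP g₀ os
    ShellWeightBound S.l₀ S.T S.A S.B S.shA S.shB S.Wsh :=
  shellWeightBound_crOfRecord₁₃VAt K₀ jcut (shellSplitOfRecord₁₃At N K₀ ρA ρB) θ hP g₀ os
    (shellWeightBound_classSet₁₃_of_cubeAC_dilation K₀ θ hP g₀ os hU hζ0 hintA hintB hϑ0 hϑ1 hMA0 hMA hMB0 hMB hdA0 hdA hdB0 hdB
      hρA0 hρAhalf hρA hρB0 hρBhalf hρB hM1A hM1B)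

end Summit.QuantumFields.YangMills.Theorems.N21DilationRoadAtRecord13CoPH
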